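import Mathlib
import Summits.Ventures.PercRepro2.Defs
import Summits.Ventures.PercRepro2.Graph
import Summits.Ventures.PercRepro2.Induced
import Summits.Ventures.PercRepro2.VdBKahn
import Summits.Ventures.PercRepro2.ReimerVdBK
import Summits.Ventures.PercRepro2.ReimerVdBKTwisted
import Summits.Ventures.PercRepro2.ReimerVdBKTied
import Summits.Ventures.PercRepro2.ReimerVdBKCoreDown
import Summits.Ventures.PercRepro2.ReimerVdBKDegTwoCalc
import Summits.Ventures.PercRepro2.ReimerVdBKOuter
import Summits.Ventures.PercRepro2.ReimerVdBKPatch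
import Summits.Ventures.PercRepro2.ReimerVdBKOuterStars
import Summits.Ventures.PercRepro2.ReimerVdBKCellEdges
import Summits.Ventures.PercRepro2.ReimerVdBKCell
import Summits.Ventures.PercRepro2.ReimerVdBKCellCoin
import Summits.Ventures.PercRepro2.ReimerVdBKCellSets

/-!
# Cell pairings give the one coin; the odd vertex of a triple adjacent to both others
(blind cell PercRepro2, mine-c g50; `conjectures/MINE-C.md` §59.1–59.3 — part VI of the cell theorem)

`oneCoin_of_cell_pairing`: any involution of the colourings that preserves every one-coin fibre and
satisfies the cell inequality `count (L ∩ cell d) ≤ count (R̂ ∩ cell (π d))` for every cell gives the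
one-coin statement `OneCoin … ∅ R` — the summation step of `ReimerVdBKCellCoin` and `ReimerVdBKCellSets`
stated once.  With it, two more shapes of the census (`MINE-C.md` §59.1 (c): the one coin of a triple with
one odd vertex survives exactly when the odd vertex is adjacent to BOTH others): `oneCoin_XXY` — `a, b ∈ X`,
`c ∈ Y`, edges `a c` and `b c`: a cell with a red edge at `c` forces `c` outside the world-1 cluster
(`X`-like: flip the outer stars and the inner `a b` edges), a cell with all edges at `c` blue forces `a`
and `b` outside the world-2 cluster (`Y`-like: keep); the mirror shape `XYY` is part VII, `ReimerVdBKCellTripleY`.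
-/

namespace Summit.Ventures.PercRepro2
namespace ReimerVdBK
open Classical

variable {V : Type*} {E : Type*} [Fintype E] [DecidableEq E] [Fintype V] [DecidableEq V]

section Pairing
variable (ends : E → Sym2 V) (s : V) (A X B Y R : Finset V)

/-- **Cell pairings give the one coin.**  An involution `π` of the colourings preserving every one-coin
fibre of `R`, with the cell inequality for every cell, gives `OneCoin … ∅ R`. -/
theorem oneCoin_of_cell_pairing (π : Config E → Config E) (hπ : Function.Involutive π)
    (hfib : ∀ c d : Config E, π d ∈ coinFibre ends c R ↔ d ∈ coinFibre ends c R)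
    (hcell : ∀ d : Config E, count (twoWorld ends s A X B Y ∩ onF (edgesTouching ends R) d) ≤
      count (twoWorld ends s (A ∪ B) ∅ ∅ (X ∪ Y) ∩ onF (edgesTouching ends R) (π d))) :
    OneCoin ends s A X B Y ∅ R := by
  intro c
  rw [coinCount_empty_N, coinCount_empty_N]
  set CE := edgesTouching ends R with hCE
  have hFib : ∀ ω ω' : Config E, (∀ e ∈ CE, ω e = ω' e) → ω ∈ coinFibre ends c R → ω' ∈ coinFibre ends c R :=
    fun ω ω' h hω => mem_shiftTied_of_agree (fun e he => h e (FE_subset_edgesAt ends _ he)) hω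
  have h1 := mul_count_inter_eq_sum_onF CE (twoWorld ends s A X B Y) (coinFibre ends c R) hFib
  have h2 := mul_count_inter_eq_sum_onF CE (twoWorld ends s (A ∪ B) ∅ ∅ (X ∪ Y)) (coinFibre ends c R) hFib
  refine Nat.le_of_mul_le_mul_left ?_ (count_univ_cell_pos ends R)
  rw [h1, h2]
  have h3 : ∀ d : Config E,
      (if d ∈ coinFibre ends c R then count (twoWorld ends s A X B Y ∩ onF CE d) else 0) ≤
        (if d ∈ coinFibre ends c R then
          count (twoWorld ends s (A ∪ B) ∅ ∅ (X ∪ Y) ∩ onF CE (π d)) else 0) := by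
    intro d
    split_ifs with hd
    · exact hcell d
    · exact le_refl 0
  calc ∑ d : Config E, (if d ∈ coinFibre ends c R then count (twoWorld ends s A X B Y ∩ onF CE d) else 0)
      ≤ ∑ d : Config E, (if d ∈ coinFibre ends c R then
          count (twoWorld ends s (A ∪ B) ∅ ∅ (X ∪ Y) ∩ onF CE (π d)) else 0) :=
        Finset.sum_le_sum fun d _ => h3 d
    _ = ∑ d : Config E, (if π d ∈ coinFibre ends c R then
          count (twoWorld ends s (A ∪ B) ∅ ∅ (X ∪ Y) ∩ onF CE (π d)) else 0) := by
        refine Finset.sum_congr rfl fun d _ => ?_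
        rw [hfib c d]
    _ = ∑ d : Config E, (if d ∈ coinFibre ends c R then
          count (twoWorld ends s (A ∪ B) ∅ ∅ (X ∪ Y) ∩ onF CE d) else 0) :=
        Equiv.sum_comp (Function.Involutive.toPerm _ hπ)
          (fun d => if d ∈ coinFibre ends c R then
            count (twoWorld ends s (A ∪ B) ∅ ∅ (X ∪ Y) ∩ onF CE d) else 0)

end Pairing

/-! ## Edge bookkeeping for triples -/

section Edges
variable (ends : E → Sym2 V)

omit [DecidableEq E] [Fintype V] in
/-- An edge with ends `{x, y}` is an edge at any set containing `x`. -/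
lemma mem_edgesTouching_of_ends {x y : V} {W : Finset V} (hx : x ∈ W) {e : E} (he : ends e = s(x, y)) :
    e ∈ edgesTouching ends W :=
  (mem_edgesAt_iff ends).2 ⟨x, hx, by rw [he]; exact Sym2.mem_mk_left _ _⟩

/-- An edge with both ends in `W` is not an outer edge of `W`. -/
lemma not_mem_FE_of_ends {x y : V} {W : Finset V} (hx : x ∈ W) (hy : y ∈ W) {e : E} (he : ends e = s(x, y)) :
    e ∉ FE ends W := by
  intro h
  obtain ⟨w, hw, hwe⟩ := (mem_outerEdges_iff ends _).1 h
  obtain ⟨z, hz, hzR⟩ := (mem_outerStar_iff ends).1 hwe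
  rw [he] at hz
  have hzm : z ∈ s(x, y) := by rw [hz]; exact Sym2.mem_mk_right _ _
  rcases Sym2.mem_iff.1 hzm with rfl | rfl
  · exact hzR hx
  · exact hzR hy

/-- The edges at `W` not in `G` are... (membership of an outer-star edge in a flip set that contains `FE`). -/
lemma mem_of_mem_outerStar_of_FE_subset {W : Finset V} {G : Finset E} (hG : FE ends W ⊆ G) {w : V} (hw : w ∈ W)
    {e : E} (he : e ∈ outerStar ends W w) : e ∈ G :=
  hG ((mem_outerEdges_iff ends _).2 ⟨w, hw, he⟩)

end Edges

/-! ## `XXY`: the `Y`-vertex adjacent to both `X`-vertices -/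

section XXY
variable (ends : E → Sym2 V) (s : V) (A X B Y : Finset V) (a b c : V)

/-- The edges flipped on the target of a red cell of `{a, b, c}`: the outer edges of the triple and the
inner edges not at `c` (the `a b` edges and the loops at `a`, `b`). -/
def xxyFlip : Finset E :=
  FE ends {a, b, c} ∪ (edgesTouching ends {a, b, c}).filter fun e => c ∉ ends e

/-- The target of a cell: the outer stars and the inner `a b` edges flipped when some edge at `c` inside
the triple is red, the cell itself otherwise. -/
def xxyTarget (d : Config E) : Config E :=
  if ∃ e, (ends e = s(a, c) ∨ ends e = s(b, c)) ∧ d e = true then flipOn (xxyFlip ends a b c) d else d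

/-- The outer edges of the triple are flipped. -/
lemma FE_subset_xxyFlip : FE ends {a, b, c} ⊆ xxyFlip ends a b c := Finset.subset_union_left

/-- An edge at the triple missing `c` is flipped. -/
lemma mem_xxyFlip_of_not_mem {e : E} (he : e ∈ edgesTouching ends {a, b, c}) (hce : c ∉ ends e) :
    e ∈ xxyFlip ends a b c :=
  Finset.mem_union_right _ (Finset.mem_filter.2 ⟨he, hce⟩)

/-- The inner edges at `c` are not flipped. -/
lemma not_mem_xxyFlip_of_inner {e : E} (he : ends e = s(a, c) ∨ ends e = s(b, c)) : e ∉ xxyFlip ends a b c := by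
  intro h
  have hcR : c ∈ ({a, b, c} : Finset V) :=
    Finset.mem_insert_of_mem (Finset.mem_insert_of_mem (Finset.mem_singleton_self _))
  have hce : c ∈ ends e := by rcases he with he | he <;> rw [he] <;> exact Sym2.mem_mk_right _ _
  rcases Finset.mem_union.1 h with h | h
  · rcases he with he | he
    · exact not_mem_FE_of_ends ends (Finset.mem_insert_self _ _) hcR he h
    · exact not_mem_FE_of_ends ends (Finset.mem_insert_of_mem (Finset.mem_insert_self _ _)) hcR he h
  · exact (Finset.mem_filter.1 h).2 hce

/-- `xxyTarget` is an involution. -/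
lemma xxyTarget_involutive : Function.Involutive (xxyTarget ends a b c) := by
  intro d
  unfold xxyTarget
  have hinv : ∀ e, (ends e = s(a, c) ∨ ends e = s(b, c)) →
      flipOn (xxyFlip ends a b c) d e = d e := by
    intro e he
    exact flipOn_of_not_mem _ (not_mem_xxyFlip_of_inner ends a b c he) d
  by_cases h : ∃ e, (ends e = s(a, c) ∨ ends e = s(b, c)) ∧ d e = true
  · rw [if_pos h]
    have h' : ∃ e, (ends e = s(a, c) ∨ ends e = s(b, c)) ∧ flipOn (xxyFlip ends a b c) d e = true := by
      obtain ⟨e, he, hde⟩ := h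
      exact ⟨e, he, by rw [hinv e he]; exact hde⟩
    rw [if_pos h', flipOn_involutive]
  · rw [if_neg h, if_neg h]

/-- `xxyTarget` preserves every one-coin fibre. -/
lemma xxyTarget_mem_coinFibre_iff (c' d : Config E) :
    xxyTarget ends a b c d ∈ coinFibre ends c' {a, b, c} ↔ d ∈ coinFibre ends c' {a, b, c} := by
  unfold xxyTarget
  by_cases h : ∃ e, (ends e = s(a, c) ∨ ends e = s(b, c)) ∧ d e = true
  · rw [if_pos h]
    exact flipOn_superset_mem_shiftTied_iff c' d (FE_subset_xxyFlip ends a b c)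
  · rw [if_neg h]

/-- **The cell inequality for `XXY` with the `Y`-vertex adjacent to both `X`-vertices.** -/
theorem count_cell_xxy_le (ha : a ∈ X) (hb : b ∈ X) (hc : c ∈ Y) (hXY : X ∩ Y = ∅)
    (hac : ∃ e, ends e = s(a, c)) (hbc : ∃ e, ends e = s(b, c)) (d : Config E) :
    count (twoWorld ends s A X B Y ∩ onF (edgesTouching ends {a, b, c}) d) ≤
      count (twoWorld ends s (A ∪ B) ∅ ∅ (X ∪ Y) ∩ onF (edgesTouching ends {a, b, c}) (xxyTarget ends a b c d)) := by
  have hcR : c ∈ ({a, b, c} : Finset V) :=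
    Finset.mem_insert_of_mem (Finset.mem_insert_of_mem (Finset.mem_singleton_self _))
  have haR : a ∈ ({a, b, c} : Finset V) := Finset.mem_insert_self _ _
  have hbR : b ∈ ({a, b, c} : Finset V) := Finset.mem_insert_of_mem (Finset.mem_insert_self _ _)
  have hnotY : ∀ w ∈ X, w ∉ Y := fun w hw hwY => Finset.notMem_empty w (hXY ▸ Finset.mem_inter.2 ⟨hw, hwY⟩)
  have hcX : c ∉ X := fun h => hnotY c h hc
  have hRX : ({a, b, c} : Finset V) ∩ X ⊆ {a, b} := by
    intro w hw
    rcases Finset.mem_insert.1 (Finset.mem_inter.1 hw).1 with rfl | hw'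
    · exact Finset.mem_insert_self _ _
    · rcases Finset.mem_insert.1 hw' with rfl | hw''
      · exact Finset.mem_insert_of_mem (Finset.mem_singleton_self _)
      · rw [Finset.mem_singleton.1 hw''] at hw
        exact absurd (Finset.mem_inter.1 hw).2 hcX
  have hRY : ({a, b, c} : Finset V) ∩ Y ⊆ {c} := by
    intro w hw
    rcases Finset.mem_insert.1 (Finset.mem_inter.1 hw).1 with rfl | hw'
    · exact absurd (Finset.mem_inter.1 hw).2 (hnotY _ ha)
    · rcases Finset.mem_insert.1 hw' with rfl | hw''
      · exact absurd (Finset.mem_inter.1 hw).2 (hnotY _ hb)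
      · exact hw''
  unfold xxyTarget
  by_cases hred : ∃ e, (ends e = s(a, c) ∨ ends e = s(b, c)) ∧ d e = true
  · -- a red edge at `c`: the triple is `X`-like
    rw [if_pos hred]
    obtain ⟨e₀, he₀, hde₀⟩ := hred
    refine count_cell_le ends s A X B Y {a, b, c} {a, b, c} {c} (Finset.inter_subset_left) hRY {a, b, c}
      (le_refl _) Finset.sdiff_subset d _ ?_ ?_ ?_ ?_ ?_ ?_
    · intro ω' hω' w hw
      obtain ⟨⟨_, hX⟩, _⟩ := hω'
      have hab : ∀ x ∈ X, ¬ Conn ends (patch (edgesTouching ends {a, b, c}) d ω') s x := fun x hx => hX x hx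
      rcases Finset.mem_insert.1 hw with rfl | hw'
      · exact hab w ha
      rcases Finset.mem_insert.1 hw' with rfl | hw''
      · exact hab w hb
      rw [Finset.mem_singleton.1 hw'']
      intro hcc
      have he₀R : e₀ ∈ edgesTouching ends {a, b, c} :=
        (mem_edgesAt_iff ends).2 ⟨c, hcR, by rcases he₀ with he₀ | he₀ <;> rw [he₀] <;> exact Sym2.mem_mk_right _ _⟩
      have hopen : patch (edgesTouching ends {a, b, c}) d ω' e₀ = true := by
        rw [patch_of_mem _ he₀R]; exact hde₀
      rcases he₀ with he₀ | he₀
      · exact hab a ha (conn_trans hcc (conn_of_openAdj ⟨e₀, hopen, by rw [he₀, Sym2.eq_swap]⟩))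
      · exact hab b hb (conn_trans hcc (conn_of_openAdj ⟨e₀, hopen, by rw [he₀, Sym2.eq_swap]⟩))
    · intro ω' hω' w hw
      obtain ⟨_, _, hY⟩ := hω'
      rw [Finset.mem_singleton.1 hw]
      exact hY c hc
    · intro e heR _ hnone
      obtain ⟨w, hw, hwe⟩ := (mem_edgesAt_iff ends).1 heR
      exact absurd hwe (hnone w hw)
    · intro e heR hnd hnone
      have hce : c ∉ ends e := hnone c (Finset.mem_singleton_self c)
      rw [flipOn_of_mem _ (mem_xxyFlip_of_not_mem ends a b c heR hce)]
    · intro w hw e he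
      exact flipOn_of_mem _ (mem_of_mem_outerStar_of_FE_subset ends (FE_subset_xxyFlip ends a b c) hw he) d
    · intro w hw
      exact absurd (Finset.mem_sdiff.1 hw).1 (Finset.mem_sdiff.1 hw).2
  · -- every edge at `c` inside the triple is blue: the triple is `Y`-like
    rw [if_neg hred]
    simp only [not_exists, not_and, Bool.not_eq_true] at hred
    obtain ⟨e₁, he₁⟩ := hac
    obtain ⟨e₂, he₂⟩ := hbc
    have hb₁ : d e₁ = false := hred e₁ (Or.inl he₁)
    have hb₂ : d e₂ = false := hred e₂ (Or.inr he₂)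
    refine count_cell_le ends s A X B Y {a, b, c} {a, b} {a, b, c} hRX Finset.inter_subset_left ∅
      (Finset.empty_subset _) ?_ d d ?_ ?_ ?_ ?_ ?_ ?_
    · intro w hw
      exact absurd (Finset.mem_sdiff.1 hw).1 (Finset.mem_sdiff.1 hw).2
    · intro ω' hω' w hw
      obtain ⟨⟨_, hX⟩, _⟩ := hω'
      rcases Finset.mem_insert.1 hw with rfl | hw'
      · exact hX w ha
      · rw [Finset.mem_singleton.1 hw']
        exact hX b hb
    · intro ω' hω' w hw
      obtain ⟨_, _, hY⟩ := hω'
      have hc' : ¬ Conn ends (compl (patch (edgesTouching ends {a, b, c}) d ω')) s c := hY c hc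
      have hblue : ∀ e, e ∈ edgesTouching ends {a, b, c} → d e = false →
          compl (patch (edgesTouching ends {a, b, c}) d ω') e = true := by
        intro e heR hde
        simp only [compl]
        rw [patch_of_mem _ heR, hde]
        rfl
      rcases Finset.mem_insert.1 hw with rfl | hw'
      · intro hcw
        exact hc' (conn_trans hcw (conn_of_openAdj ⟨e₁, hblue e₁ (mem_edgesTouching_of_ends ends haR he₁) hb₁, he₁⟩))
      rcases Finset.mem_insert.1 hw' with rfl | hw''
      · intro hcw
        exact hc' (conn_trans hcw (conn_of_openAdj ⟨e₂, hblue e₂ (mem_edgesTouching_of_ends ends hbR he₂) hb₂, he₂⟩))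
      · rw [Finset.mem_singleton.1 hw'']
        exact hc'
    · intro e _ _ _
      exact le_refl _
    · intro e heR _ hnone
      obtain ⟨w, hw, hwe⟩ := (mem_edgesAt_iff ends).1 heR
      exact absurd hwe (hnone w hw)
    · intro w hw
      exact absurd hw (Finset.notMem_empty w)
    · intro _ _ _ _
      rfl

/-- **`XXY` takes one coin when the `Y`-vertex is adjacent to both `X`-vertices** (`N = ∅`). -/
theorem oneCoin_XXY (ha : a ∈ X) (hb : b ∈ X) (hc : c ∈ Y) (hXY : X ∩ Y = ∅)
    (hac : ∃ e, ends e = s(a, c)) (hbc : ∃ e, ends e = s(b, c)) :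
    OneCoin ends s A X B Y ∅ {a, b, c} :=
  oneCoin_of_cell_pairing ends s A X B Y {a, b, c} (xxyTarget ends a b c) (xxyTarget_involutive ends a b c)
    (xxyTarget_mem_coinFibre_iff ends a b c) (count_cell_xxy_le ends s A X B Y a b c ha hb hc hXY hac hbc)

end XXY

end ReimerVdBK
end Summit.Ventures.PercRepro2
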